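import Mathlib.Algebra.Module.ZLattice.Covolume
import Mathlib.MeasureTheory.Measure.Haar.InnerProductSpace
import Mathlib.Analysis.SpecialFunctions.Pow.Real
import Literature.Algebra.EuclideanLattices.SuccessiveMinima
import Literature.Algebra.EuclideanLattices.DualLattice
import HarnessLib

-- provenance: harness21/H21/H21/Statements/PQC/LatticeGeometry.lean @ 8dffb85 (interim HEAD d8f2665); M5 mechanical rewrite
/-!
# PQC family: geometry of numbers (successive minima, Minkowski, transference)

Family `pqc`, trunk T-LATTICE (G10). Namespace `Literature.PQC`.

This statement file records:

* **pqc.S11** — successive minima `λᵢ(L)` (Cassels, *An Introduction to the Geometry of Numbers*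
  (1959), Ch. VIII §1; Peikert, *A decade of lattice cryptography* (2016), Def. 2.1.2). The
  definition is `Literature.Algebra.EuclideanLattices.successiveMinimum` (prelude `H21/Prelude/Lattice/SuccessiveMinima`);
  the acceptance form here is the characterisation
  `successiveMinimum_le_iff_exists_linearIndependent`: `λᵢ(L) ≤ r` iff the closed ball of radius
  `r` contains `i` `ℝ`-linearly independent vectors of `L`.
* **pqc.S13** — Minkowski's first and second theorems on successive minima (Cassels, op. cit.,
  Ch. VIII Thms I and V; Micciancio–Goldwasser, *Complexity of lattice problems* (2002), Thm 1.5):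
  `λ₁(L) ≤ √n · covol(L)^{1/n}`, the strong (Hermite-constant) form of the second theorem
  `∏ᵢ λᵢ(L) ≤ γₙ^{n/2} · covol(L)` for `L ⊆ ℝⁿ`, its `√n` corollary
  `(∏ᵢ λᵢ(L))^{1/n} ≤ √n · covol(L)^{1/n}`, the Hermite form `λ₁(L)² ≤ γₙ · covol(L)^{2/n}` and
  the bound `γₙ ≤ n`.
* **pqc.S24** — Banaszczyk's transference theorem (Banaszczyk, *New bounds in some transference
  theorems in the geometry of numbers*, Math. Ann. 296 (1993), Thm 2.1):
  `1 ≤ λ₁(L) · λₙ(L*)` and `λᵢ(L) · λ_{n+1-i}(L*) ≤ n`.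

The statements pqc.S10 (lattice of a basis and its determinant) and pqc.S12 (Minkowski's convex
body theorem) are already accepted in `H21/Statements/PQC/Wave0.lean` (`latticeOfBasis`,
`latticeDet`, `latticeDet_latticeOfBasis_eq_abs_det`,
`exists_ne_zero_mem_of_two_pow_mul_latticeDet_lt_measure`) and are not restated here.

## Mathlib

Mathlib has `IsZLattice`, `ZLattice.covolume` (w.r.t. a measure, default `volume`), the canonical
`measureSpaceOfInnerProductSpace`, and Minkowski's convex body theorem
(`MeasureTheory.exists_ne_zero_mem_lattice_of_measure_mul_two_pow_lt_measure`), but no successive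
minima, Hermite constant, or transference theorems (searched: `successiveMinim`, `Hermite`,
`transference`, `Banaszczyk`). We use the H21 prelude notions `Literature.Algebra.EuclideanLattices.minNorm`,
`Literature.Algebra.EuclideanLattices.successiveMinimum`, `Literature.Algebra.EuclideanLattices.hermiteConstant`, `Literature.Algebra.EuclideanLattices.dualLattice`.

## Design choices

* The ambient space for pqc.S13/S24 is a finite-dimensional real inner product space `E` with
  `[MeasurableSpace E] [BorelSpace E]`; the covolume is always taken w.r.t. the canonical `volume`
  of `measureSpaceOfInnerProductSpace` (the statements are false for a rescaled Haar measure).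
  `n = finrank ℝ E`; the hypothesis `finrank ℝ E ≠ 0` excludes the degenerate zero space, where
  `λ₁ = 0` and the `1/n`-th powers are junk.
* The strong form of Minkowski II involves `hermiteConstant n`, which is defined for
  `EuclideanSpace ℝ (Fin n)`; that statement is therefore given for `L ⊆ EuclideanSpace ℝ (Fin n)`,
  and the `√n` corollary for general `E`.
* In pqc.S24 the dual index is written `n + 1 - i` with `1 ≤ i ≤ n`, so no `ℕ`-subtraction
  truncation occurs.
* All theorems are known results in print; proofs are `sorry` except the pqc.S11 characterisation,
  which is reduced to the prelude lemma `Literature.Algebra.EuclideanLattices.successiveMinimum_le_iff`.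
-/

noncomputable section

open Module Metric MeasureTheory Literature.Algebra.EuclideanLattices

namespace Literature.Algebra.EuclideanLattices

/-! ### pqc.S11: successive minima -/

section SuccessiveMinima

variable {E : Type*} [NormedAddCommGroup E] [NormedSpace ℝ E]

/-- **pqc.S11** (successive minima; Cassels 1959, Ch. VIII §1; Peikert 2016, Def. 2.1.2).
For a discrete `ℤ`-submodule `L` of a real normed space, `i ≤ rank`, and `r ≥ 0`:
`λᵢ(L) ≤ r` if and only if there are `i` `ℝ`-linearly independent vectors of `L` in the closed
ball `closedBall 0 r` (for `i = 0` both sides hold, using `r ≥ 0`). The definition itself is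
`Literature.Algebra.EuclideanLattices.successiveMinimum`; this is its defining property (the infimum is attained by
discreteness). [cite: Cassels1959, Ch. VIII §1] -/
def successiveMinimum_le_iff_exists_linearIndependent : Prop :=
  ∀ (L : Submodule ℤ E) [DiscreteTopology L] {i : ℕ} (hi' : i ≤ finrank ℝ (Submodule.span ℝ (L : Set E))) {r : ℝ} (hr : 0 ≤ r),
    successiveMinimum L i ≤ r ↔
      ∃ v : Fin i → E, LinearIndependent ℝ v ∧ ∀ k, v k ∈ L ∧ v k ∈ closedBall (0 : E) r

/- interim proof relied on results that are now named facts (D-0014); demoted to a fact by the M5 import, proof preserved: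
:= by
  simp only [mem_closedBall_zero_iff]
  exact successiveMinimum_le_iff L hi' hr
-/

end SuccessiveMinima

/-! ### pqc.S13: Minkowski's theorems on successive minima -/

section Minkowski

variable {E : Type*} [NormedAddCommGroup E] [InnerProductSpace ℝ E] [FiniteDimensional ℝ E]
  [MeasurableSpace E] [BorelSpace E]

/-- **pqc.S13** (Minkowski's first theorem; Cassels 1959, Ch. VIII Thm I with the ball;
Micciancio–Goldwasser 2002, Thm 1.5). For a full-rank lattice `L` in an `n`-dimensional real
inner product space, `n ≠ 0`, `λ₁(L) ≤ √n · covol(L)^{1/n}` (covolume w.r.t. the canonical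
Lebesgue measure). [cite: Cassels1959, Ch. VIII Thm I with the ball] -/
def minNorm_le_sqrt_mul_covolume_rpow : Prop :=
  ∀ (L : Submodule ℤ E) [DiscreteTopology L] [IsZLattice ℝ L] (hn : finrank ℝ E ≠ 0),
    minNorm L ≤ √(finrank ℝ E : ℝ) * ZLattice.covolume L ^ (1 / (finrank ℝ E : ℝ))

/-- **pqc.S13** (Minkowski's second theorem, strong form; Cassels 1959, Ch. VIII Thm V /
Thm I applied to the unit ball; Micciancio–Goldwasser 2002, Thm 1.5). For a full-rank lattice
`L ⊆ ℝⁿ`, `n ≠ 0`, the product of the successive minima satisfies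
`∏_{i=1}^{n} λᵢ(L) ≤ γₙ^{n/2} · covol(L)`, where `γₙ` is the Hermite constant. Equivalently
`(∏ λᵢ)^{1/n} ≤ √γₙ · covol(L)^{1/n}`. [cite: Cassels1959, Ch. VIII Thm V / Thm I applied to the un] -/
def prod_successiveMinimum_le_hermiteConstant_pow_mul_covolume : Prop :=
  ∀ {n : ℕ} (hn : n ≠ 0) (L : Submodule ℤ (EuclideanSpace ℝ (Fin n))) [DiscreteTopology L] [IsZLattice ℝ L],
    ∏ i ∈ Finset.Icc 1 n, successiveMinimum L i ≤
      hermiteConstant n ^ ((n : ℝ) / 2) * ZLattice.covolume L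

/-- **pqc.S13** (Minkowski's second theorem, `√n` form; Cassels 1959, Ch. VIII Thm V;
Micciancio–Goldwasser 2002, Thm 1.5). For a full-rank lattice `L` in an `n`-dimensional real
inner product space, `n ≠ 0`, `(∏_{i=1}^{n} λᵢ(L))^{1/n} ≤ √n · covol(L)^{1/n}`. [cite: Cassels1959, Ch. VIII Thm V] -/
def prod_successiveMinimum_rpow_le_sqrt_mul_covolume_rpow : Prop :=
  ∀ (L : Submodule ℤ E) [DiscreteTopology L] [IsZLattice ℝ L] (hn : finrank ℝ E ≠ 0),
    (∏ i ∈ Finset.Icc 1 (finrank ℝ E), successiveMinimum L i) ^ (1 / (finrank ℝ E : ℝ)) ≤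
      √(finrank ℝ E : ℝ) * ZLattice.covolume L ^ (1 / (finrank ℝ E : ℝ))

/-- **pqc.S13** (Hermite form of Minkowski's first theorem; Cassels 1959, Ch. II §3 and
Ch. VIII Thm I). For a full-rank lattice `L` in an `n`-dimensional real inner product space,
`λ₁(L)² ≤ γₙ · covol(L)^{2/n}`. The case `E = EuclideanSpace ℝ (Fin n)` is the definitional
unfolding `Literature.Algebra.EuclideanLattices.minNorm_sq_le_hermiteConstant_mul` (prelude); the general case follows by
an isometry `E ≃ₗᵢ[ℝ] EuclideanSpace ℝ (Fin n)` (which preserves `volume`). The name carries the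
suffix `_covolume_rpow` to avoid clashing with the prelude lemma under `open Literature.Lattice`. [cite: Cassels1959, Ch. II §3 and Ch. VIII Thm I] -/
def minNorm_sq_le_hermiteConstant_mul_covolume_rpow : Prop :=
  ∀ (L : Submodule ℤ E) [DiscreteTopology L] [IsZLattice ℝ L],
    minNorm L ^ 2 ≤
      hermiteConstant (finrank ℝ E) * ZLattice.covolume L ^ (2 / (finrank ℝ E : ℝ))

/-- **pqc.S13** (bound on the Hermite constant from Minkowski's first theorem; Cassels 1959,
Ch. VIII Thm I; Micciancio–Goldwasser 2002, Thm 1.5). `γₙ ≤ n` (indeed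
`γₙ ≤ 4 Γ(n/2+1)^{2/n} / π ≤ n`; for `n = 0` both sides are `0`). [cite: Cassels1959, Ch. VIII Thm I] -/
def hermiteConstant_le : Prop :=
  ∀ (n : ℕ),
    hermiteConstant n ≤ n

end Minkowski

/-! ### pqc.S24: Banaszczyk's transference theorem -/

section Transference

variable {E : Type*} [NormedAddCommGroup E] [InnerProductSpace ℝ E] [FiniteDimensional ℝ E]

-- Binder repair (2026-08-16): the header instance deliberately shadows the section's, which a
-- `def` does not capture (it ranged too widely before); the overlapping-instances linter is moot.
set_option linter.overlappingInstances false in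
/-- **pqc.S24** (transference, lower bound; Banaszczyk 1993, Thm 2.1; classical, cf. Cassels
1959, Ch. VIII §5). For a full-rank lattice `L` in an `n`-dimensional real inner product space,
`n ≠ 0`, `1 ≤ λ₁(L) · λₙ(L*)`. [cite: Banaszczyk1993, Thm 2.1]
(Binder repair 2026-08-16: `[FiniteDimensional ℝ E]` is written in the header so that it is a
parameter of the elaborated constant; as a section instance unused by the body it was silently
dropped, so the fact ranged over cases the printed theorem excludes.) -/
def one_le_minNorm_mul_successiveMinimum_dual [FiniteDimensional ℝ E] : Prop :=
  ∀ (L : Submodule ℤ E) [DiscreteTopology L] [IsZLattice ℝ L] (hn : finrank ℝ E ≠ 0),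
    1 ≤ minNorm L * successiveMinimum (dualLattice L) (finrank ℝ E)

-- Binder repair (2026-08-16): the header instance deliberately shadows the section's, which a
-- `def` does not capture (it ranged too widely before); the overlapping-instances linter is moot.
set_option linter.overlappingInstances false in
/-- **pqc.S24** (transference, lower bound for all indices; Banaszczyk 1993, Thm 2.1; Cassels
1959, Ch. VIII §5 Thm VI). For a full-rank lattice `L` in an `n`-dimensional real inner product
space and `1 ≤ i ≤ n`, `1 ≤ λᵢ(L) · λ_{n+1-i}(L*)`. [cite: Banaszczyk1993, Thm 2.1]
(Binder repair 2026-08-16: `[FiniteDimensional ℝ E]` is written in the header so that it is a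
parameter of the elaborated constant; as a section instance unused by the body it was silently
dropped, so the fact ranged over cases the printed theorem excludes.) -/
def one_le_successiveMinimum_mul_dual [FiniteDimensional ℝ E] : Prop :=
  ∀ (L : Submodule ℤ E) [DiscreteTopology L] [IsZLattice ℝ L] {i : ℕ} (hi : 1 ≤ i) (hi' : i ≤ finrank ℝ E),
    1 ≤ successiveMinimum L i * successiveMinimum (dualLattice L) (finrank ℝ E + 1 - i)

-- Binder repair (2026-08-16): the header instance deliberately shadows the section's, which a
-- `def` does not capture (it ranged too widely before); the overlapping-instances linter is moot.
set_option linter.overlappingInstances false in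
/-- **pqc.S24** (Banaszczyk's transference theorem; Banaszczyk 1993, Thm 2.1). For a full-rank
lattice `L` in an `n`-dimensional real inner product space and `1 ≤ i ≤ n`,
`λᵢ(L) · λ_{n+1-i}(L*) ≤ n`. In particular `λ₁(L) · λₙ(L*) ≤ n`. [cite: Banaszczyk1993, Thm 2.1]
(Binder repair 2026-08-16: `[FiniteDimensional ℝ E]` is written in the header so that it is a
parameter of the elaborated constant; as a section instance unused by the body it was silently
dropped, so the fact ranged over cases the printed theorem excludes.) -/
def successiveMinimum_mul_dual_le [FiniteDimensional ℝ E] : Prop :=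
  ∀ (L : Submodule ℤ E) [DiscreteTopology L] [IsZLattice ℝ L] {i : ℕ} (hi : 1 ≤ i) (hi' : i ≤ finrank ℝ E),
    successiveMinimum L i * successiveMinimum (dualLattice L) (finrank ℝ E + 1 - i) ≤
      finrank ℝ E

-- Binder repair (2026-08-16): the header instance deliberately shadows the section's, which a
-- `def` does not capture (it ranged too widely before); the overlapping-instances linter is moot.
set_option linter.overlappingInstances false in
/-- **pqc.S24** (Banaszczyk's transference theorem, case `i = 1`; Banaszczyk 1993, Thm 2.1).
`λ₁(L) · λₙ(L*) ≤ n` for a full-rank lattice `L` in an `n`-dimensional real inner product space,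
`n ≠ 0`. [cite: Banaszczyk1993, Thm 2.1]
(Binder repair 2026-08-16: `[FiniteDimensional ℝ E]` is written in the header so that it is a
parameter of the elaborated constant; as a section instance unused by the body it was silently
dropped, so the fact ranged over cases the printed theorem excludes.) -/
def minNorm_mul_successiveMinimum_dual_le [FiniteDimensional ℝ E] : Prop :=
  ∀ (L : Submodule ℤ E) [DiscreteTopology L] [IsZLattice ℝ L] (hn : finrank ℝ E ≠ 0),
    minNorm L * successiveMinimum (dualLattice L) (finrank ℝ E) ≤ finrank ℝ E

/- interim proof relied on results that are now named facts (D-0014); demoted to a fact by the M5 import, proof preserved: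
:= by
  have h := successiveMinimum_mul_dual_le L (i := 1) le_rfl (Nat.one_le_iff_ne_zero.mpr hn)
  simpa [successiveMinimum_one_eq_minNorm] using h
-/

end Transference

/-! ### Discharge of pqc.S24, lower bound (Cassels Ch. VIII §5 Thm VI, left inequality) -/

section TransferenceProofs

open scoped InnerProductSpace

variable {E : Type*} [NormedAddCommGroup E] [InnerProductSpace ℝ E] [FiniteDimensional ℝ E]

/-- For a full-rank lattice `L` there is a radius `R ≥ 0` such that the lattice vectors of norm at
most `R` span the whole space: take `R = ∑ₖ ‖bₖ‖` for a `ℤ`-basis `b` of `L`, which is an `ℝ`-basis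
of `E` (`Basis.ofZLatticeBasis`). Hence the set of radii whose infimum defines `λᵢ(L)` is nonempty
for `i ≤ n`. [folklore] -/
private theorem exists_radius_finrank_le_finrank_span (L : Submodule ℤ E) [DiscreteTopology L]
    [IsZLattice ℝ L] :
    ∃ R : ℝ, 0 ≤ R ∧
      finrank ℝ E ≤ finrank ℝ (Submodule.span ℝ ((L : Set E) ∩ closedBall (0 : E) R)) := by
  classical
  set B := (Module.Free.chooseBasis ℤ L).ofZLatticeBasis ℝ L with hB
  refine ⟨∑ k, ‖B k‖, Finset.sum_nonneg fun k _ => norm_nonneg _, ?_⟩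
  have h : Submodule.span ℝ (Set.range B) ≤
      Submodule.span ℝ ((L : Set E) ∩ closedBall (0 : E) (∑ k, ‖B k‖)) := by
    refine Submodule.span_mono ?_
    rintro _ ⟨k, rfl⟩
    refine ⟨?_, ?_⟩
    · rw [SetLike.mem_coe, hB, Module.Basis.ofZLatticeBasis_apply]
      exact (Module.Free.chooseBasis ℤ L k).2
    · rw [mem_closedBall_zero_iff]
      exact Finset.single_le_sum (fun k _ => norm_nonneg (B k)) (Finset.mem_univ k)
  rw [B.span_eq] at h
  calc finrank ℝ E = finrank ℝ (⊤ : Submodule ℝ E) := by rw [finrank_top]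
    _ ≤ _ := Submodule.finrank_mono h

/-- If `λᵢ(L) < r` for a full-rank lattice `L` and `i ≤ n`, then the lattice vectors of norm at most
`r` span a subspace of dimension at least `i` (the defining set of radii is nonempty and upward
closed). No attainment of the infimum is needed. [folklore] -/
private theorem le_finrank_span_of_successiveMinimum_lt (L : Submodule ℤ E) [DiscreteTopology L]
    [IsZLattice ℝ L] {i : ℕ} (hi : i ≤ finrank ℝ E) {r : ℝ} (hr : successiveMinimum L i < r) :
    i ≤ finrank ℝ (Submodule.span ℝ ((L : Set E) ∩ closedBall (0 : E) r)) := by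
  obtain ⟨R, hR0, hR⟩ := exists_radius_finrank_le_finrank_span L
  have hne : Set.Nonempty {r : ℝ | 0 ≤ r ∧
      i ≤ finrank ℝ (Submodule.span ℝ ((L : Set E) ∩ closedBall (0 : E) r))} :=
    ⟨R, hR0, hi.trans hR⟩
  unfold successiveMinimum at hr
  obtain ⟨s, ⟨-, hs⟩, hsr⟩ := exists_lt_of_csInf_lt hne hr
  exact hs.trans (Submodule.finrank_mono (Submodule.span_mono
    (Set.inter_subset_inter_right _ (closedBall_subset_closedBall hsr.le))))

/-- **Discharge of `one_le_successiveMinimum_mul_dual`** (pqc.S24, lower transference bound):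
for a full-rank lattice `L` in an `n`-dimensional real inner product space and `1 ≤ i ≤ n`,
`1 ≤ λᵢ(L) · λ_{n+1-i}(L*)`. This is the left-hand inequality of Cassels, *An Introduction to the
Geometry of Numbers*, Ch. VIII §5, Theorem VI, eq. (1), p. 219 (`1 ≤ λⱼ λ*_{n+1-j} ≤ n!` for
`1 ≤ j ≤ n`, for a symmetric convex distance function `F` and its polar `F*`; the Euclidean norm is
self-polar and the polar lattice of Cassels, Ch. I §5 Lemma 5, is `dualLattice`), restated with the
sharp upper constant `n` by Banaszczyk (Math. Ann. 296 (1993), Thm 2.1). Proof (Cassels' dimension count, arranged so that attainment of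
the minima is not needed): if `λᵢ(L) λⱼ(L*) < 1` with `j = n + 1 - i`, pick `r > λᵢ(L)` and
`s > λⱼ(L*)` with `r s < 1`; lattice vectors `x ∈ L`, `‖x‖ ≤ r` and dual vectors `y ∈ L*`,
`‖y‖ ≤ s` have `⟪x, y⟫ ∈ ℤ` and `|⟪x, y⟫| ≤ r s < 1`, so `⟪x, y⟫ = 0`; hence
`V = span (L ∩ B_r)` and `W = span (L* ∩ B_s)` are orthogonal, so
`i + j ≤ dim V + dim W ≤ dim V + dim Vᗮ = n`, contradicting `i + j = n + 1`.
[cite: Cassels1997, Ch. VIII §5 Thm VI eq. (1), p. 219] -/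
theorem one_le_successiveMinimum_mul_dual_holds : one_le_successiveMinimum_mul_dual (E := E) := by
  intro L _ _ i hi hi'
  set n := finrank ℝ E with hn
  set a := successiveMinimum L i with ha
  set b := successiveMinimum (dualLattice L) (n + 1 - i) with hb
  have ha0 : 0 ≤ a := successiveMinimum_nonneg L i
  have hb0 : 0 ≤ b := successiveMinimum_nonneg _ _
  by_contra! hab
  -- choose `s > b` with `a * s < 1`, then `r > a` with `r * s < 1`
  obtain ⟨s, hbs, has⟩ : ∃ s : ℝ, b < s ∧ a * s < 1 := by
    rcases ha0.eq_or_lt with ha0 | ha0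
    · exact ⟨b + 1, lt_add_one b, by rw [← ha0, zero_mul]; exact one_pos⟩
    · obtain ⟨s, hbs, hs⟩ := exists_between ((lt_div_iff₀' ha0).mpr hab)
      exact ⟨s, hbs, (lt_div_iff₀' ha0).mp hs⟩
  have hs0 : 0 < s := hb0.trans_lt hbs
  obtain ⟨r, har, hrs⟩ := exists_between ((lt_div_iff₀ hs0).mpr has)
  have hrs' : r * s < 1 := (lt_div_iff₀ hs0).mp hrs
  -- the spans of the short lattice / dual-lattice vectors
  set V := Submodule.span ℝ ((L : Set E) ∩ closedBall (0 : E) r) with hV_def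
  set W := Submodule.span ℝ ((dualLattice L : Set E) ∩ closedBall (0 : E) s) with hW_def
  have hV : i ≤ finrank ℝ V := le_finrank_span_of_successiveMinimum_lt L hi' har
  have hW : n + 1 - i ≤ finrank ℝ W :=
    le_finrank_span_of_successiveMinimum_lt (dualLattice L) (by omega) hbs
  -- integrality + Cauchy–Schwarz: the two spans are orthogonal
  have hVW : V ⟂ W := by
    rw [hV_def, hW_def, Submodule.isOrtho_span]
    rintro x ⟨(hxL : x ∈ L), hxr⟩ y ⟨(hyL : y ∈ dualLattice L), hys⟩
    obtain ⟨m, hm⟩ := mem_dualLattice.mp hyL x hxL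
    have h1 : |(m : ℝ)| < 1 := by
      rw [hm]
      calc |⟪y, x⟫_ℝ| ≤ ‖y‖ * ‖x‖ := abs_real_inner_le_norm y x
        _ ≤ s * r := mul_le_mul (mem_closedBall_zero_iff.mp hys) (mem_closedBall_zero_iff.mp hxr)
            (norm_nonneg _) hs0.le
        _ < 1 := by rw [mul_comm]; exact hrs'
    have hm0 : m = 0 := Int.abs_lt_one_iff.mp (by exact_mod_cast h1)
    rw [real_inner_comm, ← hm, hm0, Int.cast_zero]
  have hfin := Submodule.finrank_add_finrank_orthogonal V
  have hWle : finrank ℝ W ≤ finrank ℝ Vᗮ := Submodule.finrank_mono hVW.ge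
  omega

end TransferenceProofs

end Literature.Algebra.EuclideanLattices
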